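import Literature.Computability.FineGrained.MinPlusToNegativeTriangleSweepProofs
import HarnessLib

/-!
# Distance product `≤₃` Negative Triangle (VW–W 2018, Thm. 4.2): the single-product driver and the discharge

The discharge of the named fact `minPlusProduct_fgReducible_negativeTriangle` of
`Literature.Computability.FineGrained.SubcubicEquivalencesAPSP` — Vassilevska Williams–Williams,
J. ACM 65 (2018), Thm. 4.2 (p. 27:14; proof pp. 27:17–18): "the product of two `n × n` matrices
over `R` can be performed in `O(n² · T(n^{1/3}) log W)` time" given a `T(n)` negative-triangle
detector, i.e. the distance product of `n × n` matrices with entries in `[-nᶜ, nᶜ] ∪ {∞}` is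
subcubically reducible, in the exact sense of `FGReducible` (VVW ICM 2018, Def. 2.1), to Negative
Triangle with weights in `[-n^{c'}, n^{c'}]`.

The word-RAM work of the printed proof — the simultaneous binary search driven by negative-triangle
queries on tripartite block graphs — is the verified *product step* `NegTriSweep.psNT c` of
`Literature.Computability.FineGrained.MinPlusToNegativeTriangleSweepProgram`, which meets the
contract `APSPPower.ProdSpec` of the square-and-multiply driver of
`Literature.Computability.FineGrained.APSPPowerDriver` (`NegTriSweep.psNT_spec`) with subcubic
budgets (`NegTriSweep.psNT_budget`); there it was composed with `O(log n)` products to give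
`APSP_fgReducible_negativeTriangle_holds`. This file supplies the missing *single-product driver*
for the input format of the zoo problem `MinPlusProduct c` (the concatenation
`⌜A⌝ ++ ⌜B⌝` of the two `encodeMatrixWithTop`s) around an arbitrary product step:

* `mpDriver ps`: relocate the input — after `SProg.relocate` the two blocks `[n, ⌜A⌝]`, `[n, ⌜B⌝]`
  sit at `dQA n` and `dQP n`, which is *literally* the operand layout of the contract, so the
  product step runs in place — set up the layout registers, and branch on `n`: for `n ≥ 2` run `ps`
  once (the codes of `A ⋆ B` replace those of `A`) and emit them with the verified output phases
  `stagePre/stageBody/finalPre/finalBody/finalPost` of the APSP driver (`stage_spec`,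
  `finalLoop_spec`, `finalPost_spec`, reused verbatim); for `n = 0` emit `[0]`; for `n = 1` (where
  the contract's bound `|a ⋆ b| ≤ n^{c+1} = 1` may fail, `|a + b| ≤ 2`) emit `[1, ⌜a + b⌝]` by a
  16-entry table of the codes of `a + b` indexed by `4 ⌜a⌝ + ⌜b⌝` (`oneOps`, `tabFn_codes`);
* `mpDriver_spec_two` (`n ≥ 2`), `mpDriver_spec_one`, `mpDriver_spec_zero`: the end-to-end
  semantics (output `⌜A ⋆ B⌝`, at most `Q n` queries, time `T n + 25 n² + 46`, resp. constant);
* **`fgReducible_MinPlusProduct_of_prodSpec`**: any product step meeting `ProdSpec c B ps E …` with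
  the budget hypotheses of `fgReducible_APSP_of_prodSpec` makes `mpDriver ps` a fine-grained
  reduction `(MinPlusProduct c, n³) ≤_FG (B, n³)` at word size `(E + 4) · width`;
* **`minPlusProduct_fgReducible_negativeTriangle_holds`** (`c' = 6c + 11`), by `NegTriSweep.psNT`.

## References

* V. Vassilevska Williams, R. R. Williams, *Subcubic equivalences between path, matrix, and
  triangle problems*, J. ACM 65 (2018), Art. 27: Thm. 4.2 (p. 27:14; proof pp. 27:17–18),
  Lemma 4.2 (p. 27:16), §4 p. 27:13 (weights grow polynomially). doi:10.1145/3186893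
* V. Vassilevska Williams, *On some fine-grained questions in algorithms and complexity*,
  Proc. ICM 2018, §2, Def. 2.1 (fine-grained reductions on the word RAM).
* T. Nipkow, G. Klein, *Concrete Semantics with Isabelle/HOL*, Springer 2014, §7, §12
  (big-step semantics, symbolic execution of straight-line code).
-/

namespace Literature.Computability.FineGrained.MPDriver

open Cryptography Cryptography.WordRAM Cryptography.WordRAM.SProg Matrix APSPPower

/-! ## The program -/

/-- Setting up the layout registers of the APSP driver (`r2 = n` — read through cell `0`, which
after `relocate` points at the relocated first input word —, `r3 = n²`, `r4 = D`, `r5 = QA`,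
`r6 = QP`, `r7 = QP2`, `r8 = OUT`, `r9 = FREE`), the operand registers of the product step
(`r16 = QA`, `r17 = QP`) and the branch flag `r10 = [n < 2]`. [folklore] -/
def setupOps : List OpSpec :=
  [(.add, .dir 2, .ind 0, .imm 0), (.mul, .dir 3, .dir 2, .dir 2), (.add, .dir 4, .dir 3, .imm 101),
    (.add, .dir 5, .dir 4, .dir 3), (.add, .dir 5, .dir 5, .imm 2),
    (.add, .dir 6, .dir 5, .dir 3), (.add, .dir 6, .dir 6, .imm 1),
    (.add, .dir 7, .dir 6, .dir 3), (.add, .dir 7, .dir 7, .imm 1),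
    (.add, .dir 8, .dir 7, .dir 3), (.add, .dir 8, .dir 8, .imm 1),
    (.add, .dir 9, .dir 8, .dir 3), (.add, .dir 9, .dir 9, .imm 2),
    (.add, .dir 16, .dir 5, .imm 0), (.add, .dir 17, .dir 6, .imm 0),
    (.lt, .dir 10, .dir 2, .imm 2)]

/-- The output `[0]` (the encoding of the empty matrix) for `n = 0`: `mem[0] := 1; mem[1] := 0`.
[folklore] -/
def zeroOps : List OpSpec :=
  [(.add, .dir 0, .imm 1, .imm 0), (.add, .dir 1, .imm 0, .imm 0)]

/-- The case `n = 1` (`A = (a)`, `B = (b)`, `|a|, |b| ≤ 1`, codes `⌜a⌝ = mem[106]`,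
`⌜b⌝ = mem[108]` after relocation, both `≤ 3`): the table of the codes `⌜a + b⌝` indexed by
`4 ⌜a⌝ + ⌜b⌝` in the registers `30, …, 45` (`tabFn`), a table look-up (by `band` of the entry with
itself, which needs no overflow reasoning), and the output `[1, ⌜a + b⌝]`:
`mem[0] := 2; mem[1] := 1; mem[2] := ⌜a + b⌝`. [folklore] -/
def oneOps : List OpSpec :=
  [(.add, .dir 30, .imm 0, .imm 0), (.add, .dir 31, .imm 0, .imm 0), (.add, .dir 32, .imm 0, .imm 0),
    (.add, .dir 33, .imm 0, .imm 0), (.add, .dir 34, .imm 0, .imm 0), (.add, .dir 35, .imm 1, .imm 0),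
    (.add, .dir 36, .imm 2, .imm 0), (.add, .dir 37, .imm 3, .imm 0), (.add, .dir 38, .imm 0, .imm 0),
    (.add, .dir 39, .imm 2, .imm 0), (.add, .dir 40, .imm 4, .imm 0), (.add, .dir 41, .imm 1, .imm 0),
    (.add, .dir 42, .imm 0, .imm 0), (.add, .dir 43, .imm 3, .imm 0), (.add, .dir 44, .imm 1, .imm 0),
    (.add, .dir 45, .imm 5, .imm 0),
    (.mul, .dir 20, .dir 106, .imm 4), (.add, .dir 20, .dir 20, .dir 108),
    (.add, .dir 20, .dir 20, .imm 30), (.band, .dir 21, .ind 20, .ind 20),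
    (.add, .dir 0, .imm 2, .imm 0), (.add, .dir 1, .imm 1, .imm 0), (.band, .dir 2, .dir 21, .dir 21)]

/-- The main path (`n ≥ 2`): one product step, then the output phases of the APSP driver (stage
the codes shifted by one above a zero sentinel, copy them down into the output cells with the
cells `0, 1` as the only registers, write the header). [folklore] -/
def mainPath (ps : SProg) : SProg :=
  seqs [ps, seq (block stagePre) (whilenz (.dir 12) (block stageBody)), block finalPre,
    whilenz (.ind 1) (block finalBody), block finalPost]

/-- **The single-product driver** with product step `ps`: relocate the input `⌜A⌝ ++ ⌜B⌝`, set up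
the layout, and branch: `n ≥ 2` → `mainPath ps`; `n = 0` → `zeroOps`; `n = 1` → `oneOps`.
[folklore] -/
def mpDriver (ps : SProg) : SProg :=
  seqs [relocate, block setupOps,
    ifz (.dir 10) (mainPath ps) (ifz (.dir 2) (block zeroOps) (block oneOps))]

/-- The driver is deterministic code. [folklore] -/
theorem mpDriver_isDeterministic (ps : SProg) : (mpDriver ps).toProgram.IsDeterministic :=
  toProgram_isDeterministic _

/-! ## The table of the case `n = 1` -/

/-- The table of the codes `⌜a + b⌝` (`a, b ∈ {⊤, 0, -1, 1}`, codes `0, 1, 2, 3`) indexed by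
`4 ⌜a⌝ + ⌜b⌝`. [folklore] -/
def tabFn (k : ℕ) : ℕ := [0, 0, 0, 0, 0, 1, 2, 3, 0, 2, 4, 1, 0, 3, 1, 5].getD k 0

/-- **The table is correct**: for weights `a, b ∈ [-1, 1] ∪ {⊤}`,
`tabFn (4 ⌜a⌝ + ⌜b⌝) = ⌜a + b⌝`. [folklore] -/
theorem tabFn_codes {a b : WithTop ℤ} (ha : IsBddWeight 1 a) (hb : IsBddWeight 1 b) :
    tabFn (4 * encodeWithTopInt a + encodeWithTopInt b) = encodeWithTopInt (a + b) := by
  rcases ha with rfl | ⟨z, rfl, hz⟩ <;> rcases hb with rfl | ⟨z', rfl, hz'⟩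
  · decide
  · obtain ⟨h1, h2⟩ := abs_le.1 hz'
    interval_cases z' <;> decide
  · obtain ⟨h1, h2⟩ := abs_le.1 hz
    interval_cases z <;> decide
  · obtain ⟨h1, h2⟩ := abs_le.1 hz
    obtain ⟨h3, h4⟩ := abs_le.1 hz'
    interval_cases z <;> interval_cases z' <;> decide

/-- The code of a `1`-bounded weight is at most `3`. [folklore] -/
theorem encode_le_three {a : WithTop ℤ} (ha : IsBddWeight 1 a) : encodeWithTopInt a ≤ 3 :=
  encodeWithTopInt_le_of_isBddWeight ha

/-- The distance product of `1 × 1` matrices is the sum of the two entries. [folklore] -/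
theorem minPlusProduct_one (A B : Matrix (Fin 1) (Fin 1) (WithTop ℤ)) :
    minPlusProduct A B 0 0 = A 0 0 + B 0 0 := by
  rw [minPlusProduct_apply, Finset.univ_unique, Finset.inf_singleton]
  rfl

section semantics

variable {n w : ℕ} {O : List ℕ → List ℕ} (A B : Matrix (Fin n) (Fin n) (WithTop ℤ))

/-! ## The input and its relocation -/

/-- The input: the concatenation of the two encoded operands. [folklore] -/
def inp : List ℕ := encodeMatrixWithTop A ++ encodeMatrixWithTop B

/-- The input has `2 n² + 2` words. [folklore] -/
theorem inp_length : (inp A B).length = 2 * (n * n) + 2 := by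
  simp [inp, encodeMatrixWithTop_length, sq]; ring

/-- Word `0` of the input is `n`. [folklore] -/
theorem inp_getD_zero : (inp A B).getD 0 0 = n := by
  have hl : (encodeMatrixWithTop A).length = n * n + 1 := by simp [encodeMatrixWithTop_length, sq]
  rw [List.getD_eq_getElem _ _ (by rw [inp_length]; omega)]
  unfold inp
  rw [List.getElem_append_left (by rw [hl]; omega), NegTriToAPSP.getElem_encodeMatrixWithTop_zero]

/-- Word `1 + (i n + j)` of the input is the code of `A i j`. [folklore] -/
theorem inp_getD_A (i j : Fin n) : (inp A B).getD ((i : ℕ) * n + j + 1) 0 = encodeWithTopInt (A i j) := by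
  have ht : (i : ℕ) * n + j < n * n := NegTriToAPSP.mul_add_lt_mul i.isLt j.isLt
  have hl : (encodeMatrixWithTop A).length = n * n + 1 := by simp [encodeMatrixWithTop_length, sq]
  rw [List.getD_eq_getElem _ _ (by rw [inp_length]; omega)]
  unfold inp
  rw [List.getElem_append_left (by rw [hl]; omega),
    NegTriToAPSP.getElem_encodeMatrixWithTop_succ _ _ ht, NegTriToAPSP.divNat_mk_mul_add,
    NegTriToAPSP.modNat_mk_mul_add]

/-- Word `n² + 1` of the input is `n` (the header of the second operand). [folklore] -/
theorem inp_getD_mid : (inp A B).getD (n * n + 1) 0 = n := by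
  have hl : (encodeMatrixWithTop A).length = n * n + 1 := by simp [encodeMatrixWithTop_length, sq]
  rw [List.getD_eq_getElem _ _ (by rw [inp_length]; omega)]
  unfold inp
  rw [List.getElem_append_right (by rw [hl])]
  simp only [hl, Nat.sub_self]
  rw [NegTriToAPSP.getElem_encodeMatrixWithTop_zero]

/-- Word `n² + 2 + (i n + j)` of the input is the code of `B i j`. [folklore] -/
theorem inp_getD_B (i j : Fin n) :
    (inp A B).getD (n * n + 2 + ((i : ℕ) * n + j)) 0 = encodeWithTopInt (B i j) := by
  have ht : (i : ℕ) * n + j < n * n := NegTriToAPSP.mul_add_lt_mul i.isLt j.isLt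
  have hl : (encodeMatrixWithTop A).length = n * n + 1 := by simp [encodeMatrixWithTop_length, sq]
  rw [List.getD_eq_getElem _ _ (by rw [inp_length]; omega)]
  unfold inp
  rw [List.getElem_append_right (by rw [hl]; omega)]
  simp only [hl, show n * n + 2 + ((i : ℕ) * n + j) - (n * n + 1) = (i : ℕ) * n + j + 1 by omega]
  rw [NegTriToAPSP.getElem_encodeMatrixWithTop_succ _ _ ht, NegTriToAPSP.divNat_mk_mul_add,
    NegTriToAPSP.modNat_mk_mul_add]

/-- All input words are below `2 ^ w` once the input width fits. [folklore] -/
theorem inp_lt (hwid : inputWidth (inp A B) ≤ w) : ∀ v ∈ inp A B, v < 2 ^ w := fun _ hv =>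
  lt_of_lt_of_le (lt_two_pow_inputWidth_of_mem _ _ hv) (Nat.pow_le_pow_right Nat.two_pos hwid)

/-- Cell `0` of the relocated memory points at the relocated first word, the address `QA`. [folklore] -/
theorem relocated_zero' : relocated (inp A B) 0 = dQA n := by
  rw [relocated_zero, inp_length, dQA_eq]

/-- **The relocated first operand header**: cell `QA` holds `n`. [folklore] -/
theorem relocated_QA : relocated (inp A B) (dQA n) = n := by
  have : dQA n = (inp A B).length + 100 + 1 := by rw [inp_length, dQA_eq]
  rw [this, relocated_base_add _ le_rfl (by rw [inp_length]; omega)]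
  exact inp_getD_zero A B

/-- **The relocated first operand**: the codes of `A` from `QA + 1` on. [folklore] -/
theorem matAt_A : MatAt (relocated (inp A B)) (dQA n) A := by
  intro i j
  have ht : (i : ℕ) * n + j < n * n := NegTriToAPSP.mul_add_lt_mul i.isLt j.isLt
  have : dQA n + 1 + ((i : ℕ) * n + j) = (inp A B).length + 100 + ((i : ℕ) * n + j + 2) := by
    rw [inp_length, dQA_eq]; omega
  rw [this, relocated_base_add _ (by omega) (by rw [inp_length]; omega),
    show (i : ℕ) * n + j + 2 - 1 = (i : ℕ) * n + j + 1 by omega]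
  exact inp_getD_A A B i j

/-- **The relocated second operand header**: cell `QP` holds `n`. [folklore] -/
theorem relocated_QP : relocated (inp A B) (dQP n) = n := by
  have : dQP n = (inp A B).length + 100 + (n * n + 2) := by rw [inp_length, dQP_eq]; omega
  rw [this, relocated_base_add _ (by omega) (by rw [inp_length]; omega),
    show n * n + 2 - 1 = n * n + 1 by omega]
  exact inp_getD_mid A B

/-- **The relocated second operand**: the codes of `B` from `QP + 1` on. [folklore] -/
theorem matAt_B : MatAt (relocated (inp A B)) (dQP n) B := by
  intro i j
  have ht : (i : ℕ) * n + j < n * n := NegTriToAPSP.mul_add_lt_mul i.isLt j.isLt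
  have : dQP n + 1 + ((i : ℕ) * n + j) = (inp A B).length + 100 + (n * n + 3 + ((i : ℕ) * n + j)) := by
    rw [inp_length, dQP_eq]; omega
  rw [this, relocated_base_add _ (by omega) (by rw [inp_length]; omega),
    show n * n + 3 + ((i : ℕ) * n + j) - 1 = n * n + 2 + ((i : ℕ) * n + j) by omega]
  exact inp_getD_B A B i j

/-- Above `QP2`, the relocated memory is `0`. [folklore] -/
theorem relocated_high' {a : ℕ} (ha : dQP2 n ≤ a) : relocated (inp A B) a = 0 :=
  relocated_of_lt _ (by rw [inp_length]; rw [dQP2_eq] at ha; omega)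

/-! ## Setup -/

-- The symbolic execution uses one uniform `simp only` read-normaliser per instruction; not every
-- lemma of the set fires at every instruction.
set_option linter.unusedSimpArgs false in
/-- **The setup block**: the layout registers (`Lay n (dFREE n)`), the operand registers
`r16 = QA`, `r17 = QP`, and the flag `r10 = [n < 2]`; the data is untouched. [folklore] -/
theorem setup_spec (hF : dFREE n < 2 ^ w) (qs : List (List ℕ)) :
    ∃ S' : ℕ → ℕ, Exec w O (block setupOps) ⟨merge (relocated (inp A B)) (relocated (inp A B)), qs⟩
        ⟨merge S' (relocated (inp A B)), qs⟩ 16 ∧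
      Lay n (dFREE n) S' ∧ S' 16 = dQA n ∧ S' 17 = dQP n ∧ S' 10 = (if n < 2 then 1 else 0) := by
  have hD := dD_eq n; have hQA := dQA_eq n; have hQP := dQP_eq n; have hQP2 := dQP2_eq n
  have hOUT := dOUT_eq n; have hFR := dFREE_eq n
  have h0 : relocated (inp A B) 0 = dQA n := relocated_zero' A B
  have hDn : relocated (inp A B) (dQA n) = n := relocated_QA A B
  have hnn : n ≤ n * n := Nat.le_mul_self n
  have key : ∀ R, execOps w (merge (relocated (inp A B)) (relocated (inp A B))) setupOps = R →
      ∃ S' : ℕ → ℕ, R = merge S' (relocated (inp A B)) ∧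
        Lay n (dFREE n) S' ∧ S' 16 = dQA n ∧ S' 17 = dQP n ∧ S' 10 = (if n < 2 then 1 else 0) := by
    intro R hR
    unfold setupOps at hR
    have htmp := execOps_cons_fwd hR; clear hR; obtain ⟨v1, hv1, hR⟩ := htmp
    simp -failIfUnchanged (disch := omega) only [Operand.write, Operand.read, merge_apply_of_lt,
      merge_apply_of_le, Function.update_self, Function.update_of_ne, update_merge_of_lt,
      update_merge_of_le, Nat.add_zero, BinOp.eval_mod, BinOp.eval_eq, BinOp.eval_band,
      BinOp.eval_shr, BinOp.eval_div, BinOp.eval_lt, BinOp.eval_add_of_lt, BinOp.eval_sub_of_le,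
      BinOp.eval_mul_of_lt, h0, hDn] at hv1 hR; subst hv1
    have htmp := execOps_cons_fwd hR; clear hR; obtain ⟨v2, hv2, hR⟩ := htmp
    simp -failIfUnchanged (disch := omega) only [Operand.write, Operand.read, merge_apply_of_lt,
      merge_apply_of_le, Function.update_self, Function.update_of_ne, update_merge_of_lt,
      update_merge_of_le, Nat.add_zero, BinOp.eval_mod, BinOp.eval_eq, BinOp.eval_band,
      BinOp.eval_shr, BinOp.eval_div, BinOp.eval_lt, BinOp.eval_add_of_lt, BinOp.eval_sub_of_le,
      BinOp.eval_mul_of_lt, h0] at hv2 hR; subst hv2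
    have htmp := execOps_cons_fwd hR; clear hR; obtain ⟨v3, hv3, hR⟩ := htmp
    simp -failIfUnchanged (disch := omega) only [Operand.write, Operand.read, merge_apply_of_lt,
      merge_apply_of_le, Function.update_self, Function.update_of_ne, update_merge_of_lt,
      update_merge_of_le, Nat.add_zero, BinOp.eval_mod, BinOp.eval_eq, BinOp.eval_band,
      BinOp.eval_shr, BinOp.eval_div, BinOp.eval_lt, BinOp.eval_add_of_lt, BinOp.eval_sub_of_le,
      BinOp.eval_mul_of_lt, h0] at hv3 hR; subst hv3
    have htmp := execOps_cons_fwd hR; clear hR; obtain ⟨v4, hv4, hR⟩ := htmp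
    simp -failIfUnchanged (disch := omega) only [Operand.write, Operand.read, merge_apply_of_lt,
      merge_apply_of_le, Function.update_self, Function.update_of_ne, update_merge_of_lt,
      update_merge_of_le, Nat.add_zero, BinOp.eval_mod, BinOp.eval_eq, BinOp.eval_band,
      BinOp.eval_shr, BinOp.eval_div, BinOp.eval_lt, BinOp.eval_add_of_lt, BinOp.eval_sub_of_le,
      BinOp.eval_mul_of_lt, h0] at hv4 hR; subst hv4
    have htmp := execOps_cons_fwd hR; clear hR; obtain ⟨v5, hv5, hR⟩ := htmp
    simp -failIfUnchanged (disch := omega) only [Operand.write, Operand.read, merge_apply_of_lt,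
      merge_apply_of_le, Function.update_self, Function.update_of_ne, update_merge_of_lt,
      update_merge_of_le, Nat.add_zero, BinOp.eval_mod, BinOp.eval_eq, BinOp.eval_band,
      BinOp.eval_shr, BinOp.eval_div, BinOp.eval_lt, BinOp.eval_add_of_lt, BinOp.eval_sub_of_le,
      BinOp.eval_mul_of_lt, h0] at hv5 hR; subst hv5
    have htmp := execOps_cons_fwd hR; clear hR; obtain ⟨v6, hv6, hR⟩ := htmp
    simp -failIfUnchanged (disch := omega) only [Operand.write, Operand.read, merge_apply_of_lt,
      merge_apply_of_le, Function.update_self, Function.update_of_ne, update_merge_of_lt,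
      update_merge_of_le, Nat.add_zero, BinOp.eval_mod, BinOp.eval_eq, BinOp.eval_band,
      BinOp.eval_shr, BinOp.eval_div, BinOp.eval_lt, BinOp.eval_add_of_lt, BinOp.eval_sub_of_le,
      BinOp.eval_mul_of_lt, h0] at hv6 hR; subst hv6
    have htmp := execOps_cons_fwd hR; clear hR; obtain ⟨v7, hv7, hR⟩ := htmp
    simp -failIfUnchanged (disch := omega) only [Operand.write, Operand.read, merge_apply_of_lt,
      merge_apply_of_le, Function.update_self, Function.update_of_ne, update_merge_of_lt,
      update_merge_of_le, Nat.add_zero, BinOp.eval_mod, BinOp.eval_eq, BinOp.eval_band,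
      BinOp.eval_shr, BinOp.eval_div, BinOp.eval_lt, BinOp.eval_add_of_lt, BinOp.eval_sub_of_le,
      BinOp.eval_mul_of_lt, h0] at hv7 hR; subst hv7
    have htmp := execOps_cons_fwd hR; clear hR; obtain ⟨v8, hv8, hR⟩ := htmp
    simp -failIfUnchanged (disch := omega) only [Operand.write, Operand.read, merge_apply_of_lt,
      merge_apply_of_le, Function.update_self, Function.update_of_ne, update_merge_of_lt,
      update_merge_of_le, Nat.add_zero, BinOp.eval_mod, BinOp.eval_eq, BinOp.eval_band,
      BinOp.eval_shr, BinOp.eval_div, BinOp.eval_lt, BinOp.eval_add_of_lt, BinOp.eval_sub_of_le,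
      BinOp.eval_mul_of_lt, h0] at hv8 hR; subst hv8
    have htmp := execOps_cons_fwd hR; clear hR; obtain ⟨v9, hv9, hR⟩ := htmp
    simp -failIfUnchanged (disch := omega) only [Operand.write, Operand.read, merge_apply_of_lt,
      merge_apply_of_le, Function.update_self, Function.update_of_ne, update_merge_of_lt,
      update_merge_of_le, Nat.add_zero, BinOp.eval_mod, BinOp.eval_eq, BinOp.eval_band,
      BinOp.eval_shr, BinOp.eval_div, BinOp.eval_lt, BinOp.eval_add_of_lt, BinOp.eval_sub_of_le,
      BinOp.eval_mul_of_lt, h0] at hv9 hR; subst hv9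
    have htmp := execOps_cons_fwd hR; clear hR; obtain ⟨v10, hv10, hR⟩ := htmp
    simp -failIfUnchanged (disch := omega) only [Operand.write, Operand.read, merge_apply_of_lt,
      merge_apply_of_le, Function.update_self, Function.update_of_ne, update_merge_of_lt,
      update_merge_of_le, Nat.add_zero, BinOp.eval_mod, BinOp.eval_eq, BinOp.eval_band,
      BinOp.eval_shr, BinOp.eval_div, BinOp.eval_lt, BinOp.eval_add_of_lt, BinOp.eval_sub_of_le,
      BinOp.eval_mul_of_lt, h0] at hv10 hR; subst hv10
    have htmp := execOps_cons_fwd hR; clear hR; obtain ⟨v11, hv11, hR⟩ := htmp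
    simp -failIfUnchanged (disch := omega) only [Operand.write, Operand.read, merge_apply_of_lt,
      merge_apply_of_le, Function.update_self, Function.update_of_ne, update_merge_of_lt,
      update_merge_of_le, Nat.add_zero, BinOp.eval_mod, BinOp.eval_eq, BinOp.eval_band,
      BinOp.eval_shr, BinOp.eval_div, BinOp.eval_lt, BinOp.eval_add_of_lt, BinOp.eval_sub_of_le,
      BinOp.eval_mul_of_lt, h0] at hv11 hR; subst hv11
    have htmp := execOps_cons_fwd hR; clear hR; obtain ⟨v12, hv12, hR⟩ := htmp
    simp -failIfUnchanged (disch := omega) only [Operand.write, Operand.read, merge_apply_of_lt,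
      merge_apply_of_le, Function.update_self, Function.update_of_ne, update_merge_of_lt,
      update_merge_of_le, Nat.add_zero, BinOp.eval_mod, BinOp.eval_eq, BinOp.eval_band,
      BinOp.eval_shr, BinOp.eval_div, BinOp.eval_lt, BinOp.eval_add_of_lt, BinOp.eval_sub_of_le,
      BinOp.eval_mul_of_lt, h0] at hv12 hR; subst hv12
    have htmp := execOps_cons_fwd hR; clear hR; obtain ⟨v13, hv13, hR⟩ := htmp
    simp -failIfUnchanged (disch := omega) only [Operand.write, Operand.read, merge_apply_of_lt,
      merge_apply_of_le, Function.update_self, Function.update_of_ne, update_merge_of_lt,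
      update_merge_of_le, Nat.add_zero, BinOp.eval_mod, BinOp.eval_eq, BinOp.eval_band,
      BinOp.eval_shr, BinOp.eval_div, BinOp.eval_lt, BinOp.eval_add_of_lt, BinOp.eval_sub_of_le,
      BinOp.eval_mul_of_lt, h0] at hv13 hR; subst hv13
    have htmp := execOps_cons_fwd hR; clear hR; obtain ⟨v14, hv14, hR⟩ := htmp
    simp -failIfUnchanged (disch := omega) only [Operand.write, Operand.read, merge_apply_of_lt,
      merge_apply_of_le, Function.update_self, Function.update_of_ne, update_merge_of_lt,
      update_merge_of_le, Nat.add_zero, BinOp.eval_mod, BinOp.eval_eq, BinOp.eval_band,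
      BinOp.eval_shr, BinOp.eval_div, BinOp.eval_lt, BinOp.eval_add_of_lt, BinOp.eval_sub_of_le,
      BinOp.eval_mul_of_lt, h0] at hv14 hR; subst hv14
    have htmp := execOps_cons_fwd hR; clear hR; obtain ⟨v15, hv15, hR⟩ := htmp
    simp -failIfUnchanged (disch := omega) only [Operand.write, Operand.read, merge_apply_of_lt,
      merge_apply_of_le, Function.update_self, Function.update_of_ne, update_merge_of_lt,
      update_merge_of_le, Nat.add_zero, BinOp.eval_mod, BinOp.eval_eq, BinOp.eval_band,
      BinOp.eval_shr, BinOp.eval_div, BinOp.eval_lt, BinOp.eval_add_of_lt, BinOp.eval_sub_of_le,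
      BinOp.eval_mul_of_lt, h0] at hv15 hR; subst hv15
    have htmp := execOps_cons_fwd hR; clear hR; obtain ⟨v16, hv16, hR⟩ := htmp
    simp -failIfUnchanged (disch := omega) only [Operand.write, Operand.read, merge_apply_of_lt,
      merge_apply_of_le, Function.update_self, Function.update_of_ne, update_merge_of_lt,
      update_merge_of_le, Nat.add_zero, BinOp.eval_mod, BinOp.eval_eq, BinOp.eval_band,
      BinOp.eval_shr, BinOp.eval_div, BinOp.eval_lt, BinOp.eval_add_of_lt, BinOp.eval_sub_of_le,
      BinOp.eval_mul_of_lt, h0] at hv16 hR; subst hv16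
    simp only [execOps_nil] at hR; subst hR
    refine ⟨_, rfl, ⟨?_, ?_, ?_, ?_, ?_, ?_, ?_, ?_⟩, ?_, ?_, ?_⟩
    all_goals simp only [Function.update_self, Function.update_of_ne, ne_eq, Nat.reduceEqDiff,
      not_false_eq_true]
    all_goals rfl
  obtain ⟨S', hR, h⟩ := key _ rfl
  exact ⟨S', Exec.block' setupOps qs hR, h⟩

/-! ## The case `n = 0` -/

-- The symbolic execution uses one uniform `simp only` read-normaliser per instruction; not every
-- lemma of the set fires at every instruction.
set_option linter.unusedSimpArgs false in
/-- **The block of the case `n = 0`**: cells `0, 1 := 1, 0`. [folklore] -/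
theorem zero_spec {S H : ℕ → ℕ} (hw : 2 ≤ 2 ^ w) (qs : List (List ℕ)) :
    ∃ S' : ℕ → ℕ, Exec w O (block zeroOps) ⟨merge S H, qs⟩ ⟨merge S' H, qs⟩ 2 ∧ S' 0 = 1 ∧ S' 1 = 0 := by
  have key : ∀ R, execOps w (merge S H) zeroOps = R →
      ∃ S' : ℕ → ℕ, R = merge S' H ∧ S' 0 = 1 ∧ S' 1 = 0 := by
    intro R hR
    unfold zeroOps at hR
    have htmp := execOps_cons_fwd hR; clear hR; obtain ⟨v1, hv1, hR⟩ := htmp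
    simp -failIfUnchanged (disch := omega) only [Operand.write, Operand.read, merge_apply_of_lt,
      merge_apply_of_le, Function.update_self, Function.update_of_ne, update_merge_of_lt,
      update_merge_of_le, Nat.add_zero, BinOp.eval_add_of_lt] at hv1 hR; subst hv1
    have htmp := execOps_cons_fwd hR; clear hR; obtain ⟨v2, hv2, hR⟩ := htmp
    simp -failIfUnchanged (disch := omega) only [Operand.write, Operand.read, merge_apply_of_lt,
      merge_apply_of_le, Function.update_self, Function.update_of_ne, update_merge_of_lt,
      update_merge_of_le, Nat.add_zero, BinOp.eval_add_of_lt] at hv2 hR; subst hv2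
    simp only [execOps_nil] at hR; subst hR
    refine ⟨_, rfl, ?_, ?_⟩
    all_goals simp only [Function.update_self, Function.update_of_ne, ne_eq, Nat.reduceEqDiff,
      not_false_eq_true]
  obtain ⟨S', hR, h⟩ := key _ rfl
  exact ⟨S', Exec.block' zeroOps qs hR, h⟩

/-! ## The case `n = 1` -/

-- The symbolic execution uses one uniform `simp only` read-normaliser per instruction; not every
-- lemma of the set fires at every instruction.
set_option linter.unusedSimpArgs false in
/-- **The block of the case `n = 1`**: with the codes `p = mem[106]`, `q = mem[108]` (both `≤ 3`),
cells `0, 1, 2 := 2, 1, tabFn (4 p + q)`. [folklore] -/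
theorem one_spec {S H : ℕ → ℕ} {p q : ℕ} (hp : H 106 = p) (hq : H 108 = q) (hp3 : p ≤ 3)
    (hq3 : q ≤ 3) (hw : 64 ≤ 2 ^ w) (qs : List (List ℕ)) :
    ∃ S' : ℕ → ℕ, Exec w O (block oneOps) ⟨merge S H, qs⟩ ⟨merge S' H, qs⟩ 23 ∧
      S' 0 = 2 ∧ S' 1 = 1 ∧ S' 2 = tabFn (4 * p + q) := by
  have key : ∀ R, execOps w (merge S H) oneOps = R →
      ∃ S' : ℕ → ℕ, R = merge S' H ∧ S' 0 = 2 ∧ S' 1 = 1 ∧ S' 2 = tabFn (4 * p + q) := by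
    intro R hR
    unfold oneOps at hR
    iterate 16
      (have htmp := execOps_cons_fwd hR; clear hR; obtain ⟨v, hv, hR⟩ := htmp
       simp -failIfUnchanged (disch := omega) only [Operand.write, Operand.read, merge_apply_of_lt,
         merge_apply_of_le, Function.update_self, Function.update_of_ne, update_merge_of_lt,
         update_merge_of_le, Nat.add_zero, BinOp.eval_add_of_lt] at hv hR; subst hv)
    have htmp := execOps_cons_fwd hR; clear hR; obtain ⟨v17, hv17, hR⟩ := htmp
    simp -failIfUnchanged (disch := omega) only [Operand.write, Operand.read, merge_apply_of_lt,
      merge_apply_of_le, Function.update_self, Function.update_of_ne, update_merge_of_lt,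
      update_merge_of_le, Nat.add_zero, BinOp.eval_mod, BinOp.eval_eq, BinOp.eval_band,
      BinOp.eval_shr, BinOp.eval_div, BinOp.eval_lt, BinOp.eval_add_of_lt, BinOp.eval_sub_of_le,
      BinOp.eval_mul_of_lt, hp, hq] at hv17 hR; subst hv17
    have htmp := execOps_cons_fwd hR; clear hR; obtain ⟨v18, hv18, hR⟩ := htmp
    simp -failIfUnchanged (disch := omega) only [Operand.write, Operand.read, merge_apply_of_lt,
      merge_apply_of_le, Function.update_self, Function.update_of_ne, update_merge_of_lt,
      update_merge_of_le, Nat.add_zero, BinOp.eval_mod, BinOp.eval_eq, BinOp.eval_band,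
      BinOp.eval_shr, BinOp.eval_div, BinOp.eval_lt, BinOp.eval_add_of_lt, BinOp.eval_sub_of_le,
      BinOp.eval_mul_of_lt, hp, hq] at hv18 hR; subst hv18
    have htmp := execOps_cons_fwd hR; clear hR; obtain ⟨v19, hv19, hR⟩ := htmp
    simp -failIfUnchanged (disch := omega) only [Operand.write, Operand.read, merge_apply_of_lt,
      merge_apply_of_le, Function.update_self, Function.update_of_ne, update_merge_of_lt,
      update_merge_of_le, Nat.add_zero, BinOp.eval_mod, BinOp.eval_eq, BinOp.eval_band,
      BinOp.eval_shr, BinOp.eval_div, BinOp.eval_lt, BinOp.eval_add_of_lt, BinOp.eval_sub_of_le,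
      BinOp.eval_mul_of_lt, hp, hq] at hv19 hR; subst hv19
    have htmp := execOps_cons_fwd hR; clear hR; obtain ⟨v20, hv20, hR⟩ := htmp
    simp -failIfUnchanged (disch := omega) only [Operand.write, Operand.read, merge_apply_of_lt,
      merge_apply_of_le, Function.update_self, Function.update_of_ne, update_merge_of_lt,
      update_merge_of_le, Nat.add_zero, BinOp.eval_mod, BinOp.eval_eq, BinOp.eval_band,
      BinOp.eval_shr, BinOp.eval_div, BinOp.eval_lt, BinOp.eval_add_of_lt, BinOp.eval_sub_of_le,
      BinOp.eval_mul_of_lt, Nat.and_self, hp, hq] at hv20 hR; subst hv20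
    have htmp := execOps_cons_fwd hR; clear hR; obtain ⟨v21, hv21, hR⟩ := htmp
    simp -failIfUnchanged (disch := omega) only [Operand.write, Operand.read, merge_apply_of_lt,
      merge_apply_of_le, Function.update_self, Function.update_of_ne, update_merge_of_lt,
      update_merge_of_le, Nat.add_zero, BinOp.eval_add_of_lt] at hv21 hR; subst hv21
    have htmp := execOps_cons_fwd hR; clear hR; obtain ⟨v22, hv22, hR⟩ := htmp
    simp -failIfUnchanged (disch := omega) only [Operand.write, Operand.read, merge_apply_of_lt,
      merge_apply_of_le, Function.update_self, Function.update_of_ne, update_merge_of_lt,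
      update_merge_of_le, Nat.add_zero, BinOp.eval_add_of_lt] at hv22 hR; subst hv22
    have htmp := execOps_cons_fwd hR; clear hR; obtain ⟨v23, hv23, hR⟩ := htmp
    simp -failIfUnchanged (disch := omega) only [Operand.write, Operand.read, merge_apply_of_lt,
      merge_apply_of_le, Function.update_self, Function.update_of_ne, update_merge_of_lt,
      update_merge_of_le, Nat.add_zero, BinOp.eval_band, Nat.and_self] at hv23 hR; subst hv23
    simp only [execOps_nil] at hR; subst hR
    refine ⟨_, rfl, ?_, ?_, ?_⟩
    · simp only [Function.update_self, Function.update_of_ne, ne_eq, Nat.reduceEqDiff,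
        not_false_eq_true]
    · simp only [Function.update_self, Function.update_of_ne, ne_eq, Nat.reduceEqDiff,
        not_false_eq_true]
    · rw [Function.update_self]
      interval_cases p <;> interval_cases q <;>
        simp [Function.update_self, Function.update_of_ne, tabFn]
  obtain ⟨S', hR, h⟩ := key _ rfl
  exact ⟨S', Exec.block' oneOps qs hR, h⟩

/-! ## The main path (`n ≥ 2`) -/

-- The symbolic execution uses one uniform `simp only` read-normaliser per instruction; not every
-- lemma of the set fires at every instruction.
set_option linter.unusedSimpArgs false in
/-- **Semantics of the main path.** From a layout store (`Lay n F S`, `F = dFREE n`) whose data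
holds the operands `X, Y` (entries and product entries `n^{c+1}`-bounded) at `QA`, `QP` and is
zero from `QP2` on, the main path ends within `T n + 11 n² + 14` steps with output `⌜X ⋆ Y⌝`,
having logged at most `Q n` queries, all encodings of `B`-instances of size `g n` and length
`≤ ℓ n`. [folklore] -/
theorem mainPath_spec {c : ℕ} {B : FGProblem} {ps : SProg} {E : ℕ} {wsp T Q g ℓ : ℕ → ℕ}
    (hP : ProdSpec c B ps E wsp T Q g ℓ) (hO : B.OracleAnswers O) {S H : ℕ → ℕ}
    {X Y : Matrix (Fin n) (Fin n) (WithTop ℤ)} (hn : 1 ≤ n) (hL : Lay n (dFREE n) S)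
    (h16 : S 16 = dQA n) (h17 : S 17 = dQP n) (hhX : H (dQA n) = n) (hhY : H (dQP n) = n)
    (hX : MatAt H (dQA n) X) (hY : MatAt H (dQP n) Y) (hbX : HasBoundedWeights X (n ^ (c + 1)))
    (hbY : HasBoundedWeights Y (n ^ (c + 1)))
    (hbXY : HasBoundedWeights (minPlusProduct X Y) (n ^ (c + 1)))
    (hz : ∀ a, dQP2 n ≤ a → H a = 0)
    (hEw : (n + 2) ^ E < 2 ^ w) (hFw : dFREE n + wsp n < 2 ^ w) (hMw : 2 * n ^ (c + 1) + 2 < 2 ^ w) :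
    ∃ (st' : Store) (bs : List B.Inst), ExecLE w O (mainPath ps) ⟨merge S H, []⟩ st'
        (T n + 11 * (n * n) + 14) ∧
      readOut st'.mem = encodeMatrixWithTop (minPlusProduct X Y) ∧ st'.queries = bs.map B.encode ∧
      bs.length ≤ Q n ∧ (∀ y ∈ bs, B.size y = g n) ∧ (∀ y ∈ bs, (B.encode y).length ≤ ℓ n) := by
  have hD := dD_eq n; have hQA := dQA_eq n; have hQP := dQP_eq n; have hQP2 := dQP2_eq n
  have hOUT := dOUT_eq n; have hFR := dFREE_eq n
  have hF : dFREE n < 2 ^ w := by omega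
  obtain ⟨h2, h3, h4, h5, h6, h7, h8, h9⟩ := hL
  -- the product step
  obtain ⟨S₁, H₁, bs, hex₁, hag, h9₁, hprod, -, -, hbl, hbs, hℓ⟩ :=
    hP (n := n) (w := w) (O := O) (S := S) (H := H) (qs := []) (X := X) (Y := Y) hO hn hEw
      (by rw [h9]; exact hFw) h2 (by rw [h16]; omega) (by rw [h17, h16]; rfl) (by rw [h17, h9]; omega)
      (by rw [h16]; exact hhX) (by rw [h17]; exact hhY) (by rw [h16]; exact hX) (by rw [h17]; exact hY)
      hbX hbY hbXY (fun a ha => hz a (by rw [h9] at ha; omega))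
  rw [List.nil_append] at hex₁
  have hL₁ : Lay n (dFREE n + wsp n) S₁ :=
    Lay.after ⟨h2, h3, h4, h5, h6, h7, h8, h9⟩ hag (by rw [h9₁, h9])
  rw [h16] at hprod
  -- staging
  set A' : ℕ → ℕ := fun t => H₁ (dQA n + 1 + t) with hAdef
  have hAw : ∀ t, t < n * n → A' t + 1 < 2 ^ w := fun t ht =>
    lt_of_le_of_lt (Nat.add_le_add_right (hprod.apply_le hbXY ht) 1) (by omega)
  obtain ⟨st₄, hex₄, S₄, H₄, rfl, h2₄, h3₄, -, -, h14₄, hout, hout1, -, hst⟩ :=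
    stage_spec (O := O) hL₁ (A := A') (fun t _ => rfl) hAw hF (bs.map B.encode)
  -- the final copy: preparation
  obtain ⟨st₅, hex₅, S₅, rfl, h0₅, h1₅⟩ : ∃ st₅, Exec w O (block finalPre)
      ⟨merge S₄ H₄, bs.map B.encode⟩ st₅ 2 ∧ ∃ S₅, st₅ = ⟨merge S₅ H₄, bs.map B.encode⟩ ∧
      S₅ 0 = n * n + 1 ∧ S₅ 1 = dOUT n + 1 + n * n := by
    refine Exec.block_of_fwd _ _ fun R hR => ?_
    unfold finalPre at hR
    have htmp := execOps_cons_fwd hR; clear hR; obtain ⟨v1, hv1, hR⟩ := htmp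
    simp -failIfUnchanged (disch := omega) only [Operand.write, Operand.read, merge_apply_of_lt,
      merge_apply_of_le, Function.update_self, Function.update_of_ne, update_merge_of_lt,
      update_merge_of_le, Nat.add_zero, BinOp.eval_mod, BinOp.eval_eq, BinOp.eval_band,
      BinOp.eval_shr, BinOp.eval_div, BinOp.eval_lt, BinOp.eval_add_of_lt, BinOp.eval_sub_of_le,
      BinOp.eval_mul_of_lt, h14₄, h3₄] at hv1 hR; subst hv1
    have htmp := execOps_cons_fwd hR; clear hR; obtain ⟨v2, hv2, hR⟩ := htmp
    simp -failIfUnchanged (disch := omega) only [Operand.write, Operand.read, merge_apply_of_lt,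
      merge_apply_of_le, Function.update_self, Function.update_of_ne, update_merge_of_lt,
      update_merge_of_le, Nat.add_zero, BinOp.eval_mod, BinOp.eval_eq, BinOp.eval_band,
      BinOp.eval_shr, BinOp.eval_div, BinOp.eval_lt, BinOp.eval_add_of_lt, BinOp.eval_sub_of_le,
      BinOp.eval_mul_of_lt, h14₄, h3₄] at hv2 hR; subst hv2
    simp only [execOps_nil] at hR; subst hR
    exact ⟨_, rfl, by simp, by simp⟩
  -- switch to the plain-memory view of the final loop
  set m₀ : ℕ → ℕ := merge S₅ H₄ with hm₀
  have hm₀0 : finMem n m₀ 0 = m₀ := by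
    funext a
    unfold finMem
    by_cases ha0 : a = 0
    · subst ha0; rw [if_pos rfl, hm₀, merge_apply_of_lt (by norm_num), h0₅]; rfl
    rw [if_neg ha0]
    by_cases ha1 : a = 1
    · subst ha1; rw [if_pos rfl, hm₀, merge_apply_of_lt (by norm_num), h1₅]; rfl
    rw [if_neg ha1, if_neg (by omega)]
  have hstaged : ∀ t, t < n * n → 1 ≤ m₀ (dOUT n + 2 + t) ∧ m₀ (dOUT n + 2 + t) < 2 ^ w := by
    intro t ht
    rw [hm₀, merge_apply_of_le (by omega), hst t ht]
    exact ⟨by omega, hAw t ht⟩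
  have hsent : m₀ (dOUT n + 1) = 0 := by rw [hm₀, merge_apply_of_le (by omega), hout1]
  have houtn : m₀ (dOUT n) = n + 1 := by rw [hm₀, merge_apply_of_le (by omega), hout]
  have hex₆ := finalLoop_spec (O := O) hstaged hsent hF (bs.map B.encode)
  rw [hm₀0, Finset.sum_const, Finset.card_range, smul_eq_mul] at hex₆
  have hex₇ := finalPost_spec (O := O) (m₀ := m₀) houtn hF (bs.map B.encode)
  -- assemble the execution
  have hexAll := hex₁.seqs_cons ((hex₄).seqs_cons (hex₅.execLE.seqs_cons (hex₆.execLE.seqs_cons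
    (ExecLE.seqs_one hex₇.execLE))))
  refine ⟨_, bs, hexAll.mono ?_, ?_, rfl, hbl, hbs, hℓ⟩
  · omega
  · -- the output
    have hmFt : ∀ t, t < n * n →
        Function.update (Function.update (finMem n m₀ (n * n)) 1 n) 0 (n * n + 1) (2 + t) = A' t := by
      intro t ht
      rw [Function.update_of_ne (by omega), Function.update_of_ne (by omega)]
      unfold finMem
      rw [if_neg (by omega), if_neg (by omega), if_pos ⟨by omega, by omega⟩, hm₀,
        merge_apply_of_le (by omega), show dOUT n + (2 + t) = dOUT n + 2 + t by omega, hst t ht,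
        Nat.add_sub_cancel]
    show readSeg (Function.update (Function.update (finMem n m₀ (n * n)) 1 n) 0 (n * n + 1)) 1
      ((Function.update (Function.update (finMem n m₀ (n * n)) 1 n) 0 (n * n + 1)) 0) = _
    rw [show (Function.update (Function.update (finMem n m₀ (n * n)) 1 n) 0 (n * n + 1)) 0 =
      n * n + 1 from Function.update_self ..]
    apply List.ext_getElem
    · rw [readSeg_length, encodeMatrixWithTop_length, sq]
    intro k hk hk'
    rw [readSeg_length] at hk
    simp only [readSeg, List.getElem_map, List.getElem_range]
    rcases k with _ | t
    · rw [Nat.add_zero, Function.update_of_ne (by omega), Function.update_self,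
        NegTriToAPSP.getElem_encodeMatrixWithTop_zero]
    · have ht : t < n * n := by omega
      have hn0 : 0 < n := hn
      rw [show 1 + (t + 1) = 2 + t by omega, hmFt t ht, hAdef]
      simp only
      rw [NegTriToAPSP.getElem_encodeMatrixWithTop_succ _ t ht]
      have key := hprod ⟨t / n, Nat.div_lt_of_lt_mul (by rwa [Nat.mul_comm] at ht)⟩
        ⟨t % n, Nat.mod_lt _ hn0⟩
      simp only at key
      rw [Nat.div_add_mod' t n] at key
      rw [key]
      rfl

/-! ## The driver, end to end -/

/-- **Semantics of the driver for `n ≥ 2`.** On the encoding of the instance `(A, B)` with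
`nᶜ`-bounded entries, at a word size accommodating the input, `(n + 2) ^ E`, one workspace and
the codes of `n^{c+1}`-bounded matrices, `mpDriver ps` ends within `T n + 25 n² + 46` steps with
output `⌜A ⋆ B⌝`, having logged at most `Q n` queries, all encodings of `B`-instances of size
`g n` and length `≤ ℓ n`. [folklore] -/
theorem mpDriver_spec_two {c : ℕ} {B' : FGProblem} {ps : SProg} {E : ℕ} {wsp T Q g ℓ : ℕ → ℕ}
    (hP : ProdSpec c B' ps E wsp T Q g ℓ) (hO : B'.OracleAnswers O) (hn : 2 ≤ n)
    (hbA : HasBoundedWeights A (n ^ c)) (hbB : HasBoundedWeights B (n ^ c))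
    (hwid : inputWidth (inp A B) ≤ w) (hEw : (n + 2) ^ E < 2 ^ w) (hFw : dFREE n + wsp n < 2 ^ w)
    (hMw : 2 * n ^ (c + 1) + 2 < 2 ^ w) :
    ∃ (st' : Store) (bs : List B'.Inst), ExecLE w O (mpDriver ps) ⟨(init w (inp A B)).mem, []⟩ st'
        (T n + 25 * (n * n) + 46) ∧
      readOut st'.mem = encodeMatrixWithTop (minPlusProduct A B) ∧ st'.queries = bs.map B'.encode ∧
      bs.length ≤ Q n ∧ (∀ y ∈ bs, B'.size y = g n) ∧ (∀ y ∈ bs, (B'.encode y).length ≤ ℓ n) := by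
  have hQA := dQA_eq n; have hQP2 := dQP2_eq n; have hFR := dFREE_eq n
  have hF : dFREE n < 2 ^ w := by omega
  -- relocate
  have hrel := relocate_exec (w := w) (O := O) (x := inp A B) (by rw [inp_length]; omega)
    (inp_lt A B hwid) (by rw [inp_length]; omega) []
  rw [← init_mem_eq_initFun hwid] at hrel
  -- setup
  obtain ⟨S₁, hex₁, hL₁, h16, h17, h10⟩ := setup_spec (O := O) A B hF []
  rw [merge_self] at hex₁
  rw [if_neg (by omega)] at h10
  -- bounds
  have hn1 : 1 ≤ n := by omega
  have hpow : n ^ c ≤ n ^ (c + 1) := by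
    rw [pow_succ]; exact Nat.le_mul_of_pos_right _ (by omega)
  have hbA' : HasBoundedWeights A (n ^ (c + 1)) := fun i j => IsBddWeight.mono (hbA i j) hpow
  have hbB' : HasBoundedWeights B (n ^ (c + 1)) := fun i j => IsBddWeight.mono (hbB i j) hpow
  have hbAB : HasBoundedWeights (minPlusProduct A B) (n ^ (c + 1)) := fun i j =>
    IsBddWeight.mono (hasBoundedWeights_minPlusProduct hbA hbB i j)
      (by rw [pow_succ]; nlinarith [Nat.one_le_pow c n hn1])
  -- the main path
  obtain ⟨st', bs, hex₂, hout, hqs, hbl, hbs, hℓ⟩ := mainPath_spec (O := O) hP hO hn1 hL₁ h16 h17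
    (relocated_QA A B) (relocated_QP A B) (matAt_A A B) (matAt_B A B) hbA' hbB' hbAB
    (fun a ha => relocated_high' A B ha) hEw hFw hMw
  have hbr : ExecLE w O (ifz (.dir 10) (mainPath ps) (ifz (.dir 2) (block zeroOps) (block oneOps)))
      ⟨merge S₁ (relocated (inp A B)), []⟩ st' (T n + 11 * (n * n) + 14 + 2) :=
    ExecLE.ifz_zero (by rw [Operand.read_dir_merge (by decide), h10]) hex₂
  have hexAll := hrel.execLE.seqs_cons (hex₁.execLE.seqs_cons (ExecLE.seqs_one hbr))
  refine ⟨st', bs, hexAll.mono ?_, hout, hqs, hbl, hbs, hℓ⟩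
  rw [inp_length]; ring_nf; omega

/-- **Semantics of the driver for `n = 0`**: output `[0]` within `36` steps, no query. [folklore] -/
theorem mpDriver_spec_zero (ps : SProg) (A B : Matrix (Fin 0) (Fin 0) (WithTop ℤ))
    (hwid : inputWidth (inp A B) ≤ w) (hw : dFREE 0 < 2 ^ w) :
    ∃ st' : Store, ExecLE w O (mpDriver ps) ⟨(init w (inp A B)).mem, []⟩ st' 36 ∧
      readOut st'.mem = encodeMatrixWithTop (minPlusProduct A B) ∧ st'.queries = [] := by
  have hFR := dFREE_eq 0
  -- relocate
  have hrel := relocate_exec (w := w) (O := O) (x := inp A B) (by rw [inp_length]; omega)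
    (inp_lt A B hwid) (by rw [inp_length]; omega) []
  rw [← init_mem_eq_initFun hwid] at hrel
  -- setup
  obtain ⟨S₁, hex₁, hL₁, -, -, h10⟩ := setup_spec (O := O) A B hw []
  rw [merge_self] at hex₁
  rw [if_pos (by omega)] at h10
  -- the zero block
  obtain ⟨S₂, hex₂, h0, h1⟩ := zero_spec (w := w) (O := O) (S := S₁) (H := relocated (inp A B))
    (by omega) []
  have hbr : ExecLE w O (ifz (.dir 10) (mainPath ps) (ifz (.dir 2) (block zeroOps) (block oneOps)))
      ⟨merge S₁ (relocated (inp A B)), []⟩ ⟨merge S₂ (relocated (inp A B)), []⟩ (2 + 2 + 2) :=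
    ExecLE.ifz_ne (by rw [Operand.read_dir_merge (by decide), h10]; decide)
      (ExecLE.ifz_zero (by rw [Operand.read_dir_merge (by decide), hL₁.r2]) hex₂.execLE)
  have hexAll := hrel.execLE.seqs_cons (hex₁.execLE.seqs_cons (ExecLE.seqs_one hbr))
  refine ⟨_, hexAll.mono (by norm_num [inp_length]), ?_, rfl⟩
  show readSeg (merge S₂ (relocated (inp A B))) 1 (merge S₂ (relocated (inp A B)) 0) = _
  rw [merge_apply_of_lt (by norm_num), h0]
  simp [readSeg, merge_apply_of_lt, h1, encodeMatrixWithTop]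

/-- **Semantics of the driver for `n = 1`**: output `[1, ⌜a + b⌝] = ⌜A ⋆ B⌝` within `71` steps,
no query. [folklore] -/
theorem mpDriver_spec_one (ps : SProg) (A B : Matrix (Fin 1) (Fin 1) (WithTop ℤ))
    (hbA : HasBoundedWeights A 1) (hbB : HasBoundedWeights B 1)
    (hwid : inputWidth (inp A B) ≤ w) (hw : dFREE 1 < 2 ^ w) :
    ∃ st' : Store, ExecLE w O (mpDriver ps) ⟨(init w (inp A B)).mem, []⟩ st' 71 ∧
      readOut st'.mem = encodeMatrixWithTop (minPlusProduct A B) ∧ st'.queries = [] := by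
  have hFR := dFREE_eq 1
  -- relocate
  have hrel := relocate_exec (w := w) (O := O) (x := inp A B) (by rw [inp_length]; omega)
    (inp_lt A B hwid) (by rw [inp_length]; omega) []
  rw [← init_mem_eq_initFun hwid] at hrel
  -- setup
  obtain ⟨S₁, hex₁, hL₁, -, -, h10⟩ := setup_spec (O := O) A B hw []
  rw [merge_self] at hex₁
  rw [if_pos (by omega)] at h10
  -- the two codes
  have hp : relocated (inp A B) 106 = encodeWithTopInt (A 0 0) := by
    have := matAt_A A B 0 0
    norm_num [dQA_eq] at this
    exact this
  have hq : relocated (inp A B) 108 = encodeWithTopInt (B 0 0) := by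
    have := matAt_B A B 0 0
    norm_num [dQP_eq] at this
    exact this
  -- the table block
  obtain ⟨S₂, hex₂, h0, h1, h2⟩ := one_spec (w := w) (O := O) (S := S₁) (H := relocated (inp A B))
    hp hq (encode_le_three (hbA 0 0)) (encode_le_three (hbB 0 0)) (by omega) []
  have hbr : ExecLE w O (ifz (.dir 10) (mainPath ps) (ifz (.dir 2) (block zeroOps) (block oneOps)))
      ⟨merge S₁ (relocated (inp A B)), []⟩ ⟨merge S₂ (relocated (inp A B)), []⟩ (23 + 2 + 2) :=
    ExecLE.ifz_ne (by rw [Operand.read_dir_merge (by decide), h10]; decide)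
      (ExecLE.ifz_ne (by rw [Operand.read_dir_merge (by decide), hL₁.r2]; decide) hex₂.execLE)
  have hexAll := hrel.execLE.seqs_cons (hex₁.execLE.seqs_cons (ExecLE.seqs_one hbr))
  refine ⟨_, hexAll.mono (by norm_num [inp_length]), ?_, rfl⟩
  show readSeg (merge S₂ (relocated (inp A B))) 1 (merge S₂ (relocated (inp A B)) 0) = _
  rw [merge_apply_of_lt (by norm_num), h0]
  have hcode : tabFn (4 * encodeWithTopInt (A 0 0) + encodeWithTopInt (B 0 0)) =
      encodeWithTopInt (minPlusProduct A B 0 0) := by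
    rw [minPlusProduct_one]; exact tabFn_codes (hbA 0 0) (hbB 0 0)
  rw [show encodeMatrixWithTop (minPlusProduct A B) = [1, encodeWithTopInt (minPlusProduct A B 0 0)]
    from rfl]
  simp [readSeg, List.range_succ, merge_apply_of_lt, h1, h2, hcode]

end semantics

/-! ## The reduction -/

section reduction

variable {c : ℕ} {B : FGProblem} {ps : SProg} {E : ℕ} {wsp T Q g ℓ : ℕ → ℕ}

/-- The accepted output of the distance-product problem is the encoded product. [folklore] -/
theorem MinPlusProduct_good (c : ℕ) (M : (MinPlusProduct c).Inst) :
    (MinPlusProduct c).Good M = {encodeMatrixWithTop (minPlusProduct M.1.2.1 M.1.2.2)} := rfl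

/-- The size of a distance-product instance is the dimension. [folklore] -/
theorem MinPlusProduct_size (c : ℕ) (M : (MinPlusProduct c).Inst) : (MinPlusProduct c).size M = M.1.1 :=
  rfl

/-- The encoding of a distance-product instance is the concatenation of the two blocks. [folklore] -/
theorem MinPlusProduct_encode (c : ℕ) (M : (MinPlusProduct c).Inst) :
    (MinPlusProduct c).encode M = inp M.1.2.1 M.1.2.2 := rfl

/-- The main-path time is within the APSP driver's budget `Tdrv T n + 1` for `n ≥ 1`. [folklore] -/
theorem time_le_Tdrv {T : ℕ → ℕ} {n : ℕ} (hn : 1 ≤ n) :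
    T n + 25 * (n * n) + 46 + 1 ≤ Tdrv T n + 1 := by
  have hs : 1 ≤ Nat.size n := Nat.size_pos.2 hn
  unfold Tdrv
  have : 2 * T n + 6 * (n * n) + 18 ≤ Nat.size n * (2 * T n + 6 * (n * n) + 18) :=
    Nat.le_mul_of_pos_left _ hs
  omega

/-- **Semantics of the driver for `n < 2`** (uniformly): output `⌜A ⋆ B⌝` within `71` steps,
no query. [folklore] -/
theorem mpDriver_spec_small (ps : SProg) {m : ℕ} (hm : m < 2) (A B : Matrix (Fin m) (Fin m) (WithTop ℤ))
    (hbA : HasBoundedWeights A (m ^ c)) (hbB : HasBoundedWeights B (m ^ c)) {w : ℕ}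
    {O : List ℕ → List ℕ} (hwid : inputWidth (inp A B) ≤ w) (hw : dFREE m < 2 ^ w) :
    ∃ st' : Store, ExecLE w O (mpDriver ps) ⟨(init w (inp A B)).mem, []⟩ st' 71 ∧
      readOut st'.mem = encodeMatrixWithTop (minPlusProduct A B) ∧ st'.queries = [] := by
  interval_cases m
  · obtain ⟨st', hex, hout, hqs⟩ := mpDriver_spec_zero (O := O) ps A B hwid hw
    exact ⟨st', hex.mono (by norm_num), hout, hqs⟩
  · rw [one_pow] at hbA hbB
    exact mpDriver_spec_one (O := O) ps A B hbA hbB hwid hw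

/-- **The single-product driver is a fine-grained reduction.** Given a product step `ps` meeting
the contract `ProdSpec c B ps E wsp T Q g ℓ` with `5 ≤ E`, `c + 3 ≤ E`, a workspace of at most
`(n + 2)^E` words, and the budget hypotheses of `fgReducible_APSP_of_prodSpec` (the APSP driver's
time `Tdrv T n + 1`, oracle ledger `2 · size n · Q n · ((g n)³)^{1-ε}` and total query length
`2 · size n · Q n · ℓ n` all `≤ C · (n³)^{1-δ} + C`) — which dominate the single product's time
`T n + 25 n² + 47`, ledger `Q n · ((g n)³)^{1-ε}` and query length `Q n · ℓ n` — the distance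
product with entries in `[-nᶜ, nᶜ]` is subcubically reducible to `B` (VVW ICM 2018, Def. 2.1, via
`mpDriver ps` at word size `(E + 4) · width`, constant `C + 200`). [folklore] -/
theorem fgReducible_MinPlusProduct_of_prodSpec (hP : ProdSpec c B ps E wsp T Q g ℓ) (hE5 : 5 ≤ E)
    (hEc : c + 3 ≤ E) (hwsp : ∀ n, wsp n ≤ (n + 2) ^ E)
    (hbudget : ∀ ε : ℝ, 0 < ε → ∃ δ : ℝ, 0 < δ ∧ ∃ C : ℝ, ∀ n : ℕ,
      ((Tdrv T n + 1 : ℕ) : ℝ) ≤ C * ((n : ℝ) ^ (3 : ℝ)) ^ (1 - δ) + C ∧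
      ((2 * Nat.size n * Q n : ℕ) : ℝ) * (((g n : ℕ) : ℝ) ^ (3 : ℝ)) ^ (1 - ε) ≤
        C * ((n : ℝ) ^ (3 : ℝ)) ^ (1 - δ) + C ∧
      ((2 * Nat.size n * Q n * ℓ n : ℕ) : ℝ) ≤ C * ((n : ℝ) ^ (3 : ℝ)) ^ (1 - δ) + C) :
    FGReducible (MinPlusProduct c) (fun n => (n : ℝ) ^ (3 : ℝ)) B (fun n => (n : ℝ) ^ (3 : ℝ)) := by
  intro ε hε
  obtain ⟨δ, hδ, C, hC⟩ := hbudget ε hε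
  -- the constant is nonnegative (instance `n = 0` of the time budget)
  have hC0 : 0 ≤ C := by
    obtain ⟨h0, -, -⟩ := hC 0
    by_contra hneg
    rw [not_le] at hneg
    have hB0 : (0 : ℝ) ≤ (((0 : ℕ) : ℝ) ^ (3 : ℝ)) ^ (1 - δ) := Real.rpow_nonneg (by simp) _
    have h46 : (0 : ℝ) ≤ ((Tdrv T 0 + 1 : ℕ) : ℝ) := Nat.cast_nonneg _
    nlinarith
  refine ⟨δ, hδ, (mpDriver ps).toProgram, E + 4, C + 200, mpDriver_isDeterministic ps, ?_⟩
  intro O hO x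
  obtain ⟨⟨n, A, B'⟩, hbA, hbB⟩ := x
  change HasBoundedWeights A (n ^ c) at hbA
  change HasBoundedWeights B' (n ^ c) at hbB
  obtain ⟨hC1, hC2, hC3⟩ := hC n
  simp only [MinPlusProduct_good, MinPlusProduct_size, MinPlusProduct_encode, FGProblem.width]
  -- the word size
  set w := (E + 4) * inputWidth (inp A B') with hw
  have hwid : inputWidth (inp A B') ≤ w := Nat.le_mul_of_pos_left _ (by omega)
  have hcap : ∀ v, v < (n * n + 2) ^ (E + 4) → v < 2 ^ w := fun v hv => by
    have h1 : (n * n + 2) ^ (E + 4) ≤ ((inp A B').length + 1) ^ (E + 4) := by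
      rw [inp_length]; exact Nat.pow_le_pow_left (by omega) _
    exact lt_two_pow_mul_inputWidth (lt_of_lt_of_le hv h1)
  have hEw : (n + 2) ^ E < 2 ^ w := hcap _ (pow_lt_capacity n E)
  have hFw2 : dFREE n + 2 * Nat.size n * wsp n < 2 ^ w :=
    hcap _ (by rw [dFREE_eq]; exact address_bound_lt hE5 (hwsp n))
  have hMw : 2 * n ^ (c + 1) + 2 < 2 ^ w := lt_of_le_of_lt (code_bound_le hEc) hEw
  set Bud : ℝ := ((n : ℝ) ^ (3 : ℝ)) ^ (1 - δ) with hBud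
  have hBud0 : 0 ≤ Bud := Real.rpow_nonneg (Real.rpow_nonneg (Nat.cast_nonneg _) _) _
  have h200 : (0 : ℝ) ≤ 200 * Bud := by positivity
  rcases Nat.lt_or_ge n 2 with hn2 | hn2
  · -- the small cases: no query, constant time
    obtain ⟨st', ⟨t, ht, hex⟩, hout, hqs⟩ :=
      mpDriver_spec_small (c := c) ps hn2 A B' hbA hbB (O := O) hwid (by omega)
    refine ⟨st'.cfg none 0, [], ?_, ?_, by simpa using hqs, ?_, ?_⟩
    · refine haltsWithin_toProgram hex (Nat.le_floor ?_) zeroCoins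
      have : ((t + 1 : ℕ) : ℝ) ≤ 72 := by exact_mod_cast (show t + 1 ≤ 72 by omega)
      nlinarith
    · rw [Set.mem_singleton_iff]; exact hout
    · simp only [List.map_nil, List.sum_nil]; positivity
    · simp only [List.map_nil, List.sum_nil, Nat.cast_zero]; positivity
  · -- the main case
    have hn1 : 1 ≤ n := by omega
    have hs : 1 ≤ Nat.size n := Nat.size_pos.2 hn1
    have hQle : Q n ≤ 2 * Nat.size n * Q n := by nlinarith
    have hFw : dFREE n + wsp n < 2 ^ w := by
      have : wsp n ≤ 2 * Nat.size n * wsp n := by nlinarith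
      omega
    obtain ⟨st', bs, ⟨t, ht, hex⟩, hout, hqs, hbl, hbs, hℓ⟩ :=
      mpDriver_spec_two (O := O) A B' hP hO hn2 hbA hbB hwid hEw hFw hMw
    refine ⟨st'.cfg none 0, bs, ?_, ?_, hqs, ?_, ?_⟩
    · -- halting within the budget
      refine haltsWithin_toProgram hex (Nat.le_floor ?_) zeroCoins
      have h1 : t + 1 ≤ Tdrv T n + 1 := le_trans (by omega) (time_le_Tdrv (T := T) hn1)
      have h2 : ((t + 1 : ℕ) : ℝ) ≤ C * Bud + C := le_trans (by exact_mod_cast h1) hC1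
      nlinarith
    · rw [Set.mem_singleton_iff]; exact hout
    · -- the oracle ledger
      have hK : ∀ y ∈ bs, (fun y : B.Inst => ((B.size y : ℝ) ^ (3 : ℝ)) ^ (1 - ε)) y ≤
          (((g n : ℕ) : ℝ) ^ (3 : ℝ)) ^ (1 - ε) := fun y hy => by
        simp only [hbs y hy]; exact le_rfl
      have hsum := List.sum_le_card_nsmul (bs.map fun y => ((B.size y : ℝ) ^ (3 : ℝ)) ^ (1 - ε))
        ((((g n : ℕ) : ℝ) ^ (3 : ℝ)) ^ (1 - ε)) (fun x hx => by
          obtain ⟨y, hy, rfl⟩ := List.mem_map.1 hx; exact hK y hy)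
      rw [List.length_map, nsmul_eq_mul] at hsum
      refine le_trans hsum ?_
      have hK0 : (0 : ℝ) ≤ (((g n : ℕ) : ℝ) ^ (3 : ℝ)) ^ (1 - ε) :=
        Real.rpow_nonneg (Real.rpow_nonneg (Nat.cast_nonneg _) _) _
      have hbl' : (bs.length : ℝ) ≤ ((2 * Nat.size n * Q n : ℕ) : ℝ) := by
        exact_mod_cast hbl.trans hQle
      have h3 : (bs.length : ℝ) * ((((g n : ℕ) : ℝ) ^ (3 : ℝ)) ^ (1 - ε)) ≤ C * Bud + C :=
        le_trans (mul_le_mul_of_nonneg_right hbl' hK0) hC2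
      linarith
    · -- the total query length
      have hsum := List.sum_le_card_nsmul (bs.map fun y => (B.encode y).length) (ℓ n)
        (fun x hx => by obtain ⟨y, hy, rfl⟩ := List.mem_map.1 hx; exact hℓ y hy)
      rw [List.length_map, smul_eq_mul] at hsum
      have h1 : bs.length * ℓ n ≤ 2 * Nat.size n * Q n * ℓ n :=
        Nat.mul_le_mul_right _ (hbl.trans hQle)
      have h2 : (((bs.map fun y => (B.encode y).length).sum : ℕ) : ℝ) ≤ C * Bud + C :=
        le_trans (by exact_mod_cast hsum.trans h1) hC3
      linarith

end reduction

end Literature.Computability.FineGrained.MPDriver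

namespace Literature.Computability.FineGrained

open Cryptography Cryptography.WordRAM APSPPower NegTriSweep MPDriver

/-! ## Distance product `≤₃` Negative Triangle -/

/-- **Discharge of `minPlusProduct_fgReducible_negativeTriangle`** (Vassilevska Williams–Williams,
J. ACM 65 (2018), Thm. 4.2, p. 27:14: "Matrix Product Over `R` `≤₃` Negative Triangle Over `R` …
the product of two `n × n` matrices over `R` can be performed in `O(n² · T(n^{1/3}) log W)` time";
proof pp. 27:17–18, the simultaneous binary search driven by the `IJ`-disjoint negative-triangle
listing of Lemma 4.2): for every weight exponent `c`, the distance product of `n × n` matrices with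
entries in `[-nᶜ, nᶜ] ∪ {∞}` reduces subcubically, in the exact sense of `FGReducible` (VVW ICM
2018, Def. 2.1), to Negative Triangle with weights in `[-n^{6c+11}, n^{6c+11}]` — by the
single-product driver `MPDriver.mpDriver` around the verified cell-sweep product step
`NegTriSweep.psNT` (`psNT_spec`, `psNT_budget`).
[cite: VassilevskaWilliamsWilliams2018, Thm. 4.2 (p. 27:14; proof pp. 27:17–18)] -/
theorem minPlusProduct_fgReducible_negativeTriangle_holds :
    minPlusProduct_fgReducible_negativeTriangle := fun c =>
  ⟨6 * c + 11, fgReducible_MinPlusProduct_of_prodSpec (psNT_spec c) (by omega) (by omega)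
    (fun n => (wspNT_le n).trans (Nat.pow_le_pow_right (by omega) (by omega))) (psNT_budget c)⟩

end Literature.Computability.FineGrained
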